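import Literature.NumberTheory.EllipticCurves.AdditiveReductionRamifiedTorsionLevelProofs
import Literature.NumberTheory.DiophantineGeometry.ConductorRingOfIntegersProofs
import Literature.NumberTheory.DiophantineGeometry.ConductorFactorizationProofs
import Literature.NumberTheory.DiophantineGeometry.ConductorAdditiveProofs
import HarnessLib

/-!
# Cartan cover at `3`, the Carayol cut of the Galois leaf — RAMIFIED half: `V[3]` is ramified at every Cartan place `q ≠ 3`

Helper file for the crux `EulerHalvesAtThree` of route `ClassRecordThree` (node served: residue crux
`EulerHalvesAtThreeResidualUpperBound`, line `cartan`, item NUM := `CartanOnePlaceDegreeLawAtThree`; its one arithmetic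
input is `CartanCover.SaturationAtThree` (D4), reduced by line `charext` to the Galois leaf
`NoModThreePeriodCharacterExtension` (OBS)). Transfer lens (sibling: the level-lowering OBSTRUCTION of Carayol–Ribet,
"a mod-`ℓ` eigenclass of level prime to `q` has `ρ̄` unramified at `q`", against "additive at `q ≠ ℓ` forces `ρ̄_{E,ℓ}`
ramified at `q`"): OBS is cut as CAR + RAM, where
* CAR (the obstruction, typed on the crux work-file side, NOT here): a `3`-integral extension of the period character of
  `Γ(D, M; C)` to the cover units at `q` forces `ρ̄_{V,3}` UNRAMIFIED at `q`;
* RAM (THIS FILE, a theorem): `ρ̄_{V,3}` is RAMIFIED at every Cartan place `q ≠ 3` of `V`. Indeed `q ∈ C` and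
  `D · M · ∏_{p ∈ C} p² = N(V)` give `q² ∣ N(V)` (§4), i.e. `f_v(V) ≥ 2` at the place `v ∋ q` of `𝓞 ℚ` (§2, Silverman ATAEC
  IV.10.2(c) = tree `two_le_conductorExponent_iff_holds`, with the `ℤ`-versus-`𝓞 ℚ` conductor bridge
  `conductorExponent_eq_of_primesEquiv_eq` and `factorization_conductorNorm_holds`), i.e. ADDITIVE reduction at `v`; and at an
  additive place `v ∤ 3` the inertia group `I_v ≤ Γ_ℚ` (tree `GreenbergSelmer.inertia v`) moves a point of `V[3](ℚ̄)` (§3,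
  Silverman AEC VII.6.1 and the proof of VII.7.1 — Néron–Ogg–Shafarevich with Serre–Tate — = tree
  `WeierstrassCurve.exists_mem_inertia_smul_geomTorsion_ne_of_hasAdditiveReductionAt`).
So OBS follows from CAR by contradiction with §4 (`not_threeTorsion_unramified_of_mem_cartanPlaces` is the negation of CAR's
conclusion for the curve `V` of D4 ∕ OBS). The hypotheses `3 ∣ c_q(V)`, `q ≡ 1 (mod 3)`, `Surj V 3`, `ClassX11b V 3` and global
minimality of D4 are NOT used: additive reduction at `q ≠ 3` suffices (as the standing disprover of NUM and line `charext` remarked).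
No definition is introduced; nothing is proved about NUM, D4, OBS, CAR or any summit statement (BSD is proved here for no curve).
[cite: SilvermanAEC2009, Thm. VII.6.1 and proof of Thm. VII.7.1] [cite: Silverman1994, IV.10.2(c)] [cite: SilvermanAEC2009, C.16]
-/

set_option linter.dupNamespace false
set_option autoImplicit false

open scoped NumberField
open NumberField IsDedekindDomain Rat.HeightOneSpectrum WeierstrassCurve
open Literature.NumberTheory.EllipticCurves

namespace Summit.BirchSwinnertonDyer.BirchSwinnertonDyer.Theorems.CartanCarayol

/-! ## §1 Places of `𝓞 ℚ` over a rational prime -/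

/-- `(n : 𝓞 ℚ) ∈ v ↔ ℓ_v ∣ n` for a finite place `v` of `ℚ` (`ℓ_v = natGenerator v`, Mathlib `natGenerator_dvd_iff`; for a prime `n = q` this is
`ℓ_v = q`, tree `Literature.NumberTheory.GaloisRepresentations.natGenerator_eq_of_natCast_mem_asIdeal`, whose two-line proof is inlined below to keep the
imports of this helper light). [folklore] -/
theorem natCast_mem_asIdeal_iff_natGenerator_dvd (v : HeightOneSpectrum (𝓞 ℚ)) (n : ℕ) :
    (n : 𝓞 ℚ) ∈ v.asIdeal ↔ natGenerator v ∣ n := by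
  rw [natGenerator_dvd_iff, ← map_natCast (Rat.IsIntegralClosure.intEquiv (𝓞 ℚ)) n, Ideal.apply_mem_of_equiv_iff]

/-- The place `primesEquiv.symm q` of `𝓞 ℚ` over the prime `q` contains `q`. [folklore] -/
theorem natCast_mem_asIdeal_primesEquiv_symm {q : ℕ} (hq : q.Prime) :
    (q : 𝓞 ℚ) ∈ ((primesEquiv (R := 𝓞 ℚ)).symm ⟨q, hq⟩).asIdeal := by
  rw [natCast_mem_asIdeal_iff_natGenerator_dvd]
  exact dvd_of_eq (congrArg Subtype.val ((primesEquiv (R := 𝓞 ℚ)).apply_symm_apply ⟨q, hq⟩))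

/-! ## §2 `q² ∣ N(V)` ⟹ additive reduction at the place over `q` -/

/-- **`ord_q N(V) = f_v(V)`** at a place `v ∋ q` of `𝓞 ℚ` (`N(V) = ∏ ℓ^{f_ℓ}`, Silverman AEC C.16, tree `factorization_conductorNorm_holds`
over `ℤ`, and the `ℤ`-versus-`𝓞 ℚ` bridge `conductorExponent_eq_of_primesEquiv_eq`). [cite: SilvermanAEC2009, C.16] -/
theorem factorization_conductorNorm_eq_conductorExponent_of_mem (V : WeierstrassCurve ℚ) [V.IsElliptic]
    {v : HeightOneSpectrum (𝓞 ℚ)} {q : ℕ} (hq : q.Prime) (hv : (q : 𝓞 ℚ) ∈ v.asIdeal) :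
    (V.conductorNorm ℤ).factorization q = V.conductorExponent v := by
  have h1 := factorization_conductorNorm_holds V ((primesEquiv (R := ℤ)).symm ⟨q, hq⟩)
  rw [show natGenerator ((primesEquiv (R := ℤ)).symm ⟨q, hq⟩) = q from
    congrArg Subtype.val ((primesEquiv (R := ℤ)).apply_symm_apply ⟨q, hq⟩)] at h1
  rw [h1]
  have hgen : natGenerator v = q :=
    (Nat.prime_dvd_prime_iff_eq (prime_natGenerator v) hq).mp ((natCast_mem_asIdeal_iff_natGenerator_dvd v q).mp hv)
  refine conductorExponent_eq_of_primesEquiv_eq _ _ V ?_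
  rw [Equiv.apply_symm_apply]
  exact Subtype.ext hgen.symm

/-- **`q² ∣ N(V)` ⟹ `V` has ADDITIVE reduction at the place `v ∋ q`** (`f_v ≥ 2 ↔` additive, Silverman ATAEC IV.10.2(c), tree
`two_le_conductorExponent_iff_holds`). [cite: Silverman1994, IV.10.2(c)] -/
theorem hasAdditiveReductionAt_of_sq_dvd_conductorNorm (V : WeierstrassCurve ℚ) [V.IsElliptic]
    {v : HeightOneSpectrum (𝓞 ℚ)} {q : ℕ} (hq : q.Prime) (hv : (q : 𝓞 ℚ) ∈ v.asIdeal)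
    (hsq : q ^ 2 ∣ V.conductorNorm ℤ) : V.HasAdditiveReductionAt v := by
  haveI : PerfectField (IsLocalRing.ResidueField (v.adicCompletionIntegers ℚ)) := PerfectField.ofFinite
  refine (two_le_conductorExponent_iff_holds v V).mp ?_
  rw [← factorization_conductorNorm_eq_conductorExponent_of_mem V hq hv]
  exact (hq.pow_dvd_iff_le_factorization (V.conductorNorm_pos_holds).ne').mp hsq

/-- Conversely, ADDITIVE reduction at `v ∋ q` gives `q² ∣ N(V)`. [cite: Silverman1994, IV.10.2(c)] -/
theorem sq_dvd_conductorNorm_of_hasAdditiveReductionAt (V : WeierstrassCurve ℚ) [V.IsElliptic]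
    {v : HeightOneSpectrum (𝓞 ℚ)} {q : ℕ} (hq : q.Prime) (hv : (q : 𝓞 ℚ) ∈ v.asIdeal)
    (hadd : V.HasAdditiveReductionAt v) : q ^ 2 ∣ V.conductorNorm ℤ := by
  haveI : PerfectField (IsLocalRing.ResidueField (v.adicCompletionIntegers ℚ)) := PerfectField.ofFinite
  refine (hq.pow_dvd_iff_le_factorization (V.conductorNorm_pos_holds).ne').mpr ?_
  rw [factorization_conductorNorm_eq_conductorExponent_of_mem V hq hv]
  exact (two_le_conductorExponent_iff_holds v V).mpr hadd

/-! ## §3 RAM: at a place `v ∋ q`, `q ≠ 3`, `q² ∣ N(V)`, inertia moves a `3`-torsion point -/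

/-- **`V[3]` is RAMIFIED at `q`** for a prime `q ≠ 3` with `q² ∣ N(V)`: some `σ` of the inertia group `I_v ≤ Γ_ℚ` at the place
`v ∋ q` moves some `P ∈ V[3](ℚ̄)` (additive at `v ∤ 3`, §2; Silverman AEC VII.6.1 and proof of VII.7.1, tree
`exists_mem_inertia_smul_geomTorsion_ne_of_hasAdditiveReductionAt`).
[cite: SilvermanAEC2009, Thm. VII.6.1 and proof of Thm. VII.7.1] [cite: Silverman1994, IV.10.2(c)] -/
theorem exists_mem_inertia_smul_threeTorsion_ne_of_sq_dvd_conductorNorm (V : WeierstrassCurve ℚ) [V.IsElliptic]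
    {q : ℕ} (hq : q.Prime) (hq3 : q ≠ 3) (hsq : q ^ 2 ∣ V.conductorNorm ℤ)
    (v : HeightOneSpectrum (𝓞 ℚ)) (hv : (q : 𝓞 ℚ) ∈ v.asIdeal) :
    ∃ σ ∈ GreenbergSelmer.inertia v, ∃ P : geomTorsion V (3 : ℤ), σ • P ≠ P := by
  -- `v ∤ 3`: `ℓ_v = q ≠ 3`
  have hgen : natGenerator v = q :=
    (Nat.prime_dvd_prime_iff_eq (prime_natGenerator v) hq).mp ((natCast_mem_asIdeal_iff_natGenerator_dvd v q).mp hv)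
  have h3v : ((3 : ℕ) : 𝓞 ℚ) ∉ v.asIdeal := fun h ↦
    hq3 (hgen.symm.trans ((Nat.prime_dvd_prime_iff_eq (prime_natGenerator v) Nat.prime_three).mp
      ((natCast_mem_asIdeal_iff_natGenerator_dvd v 3).mp h)))
  exact V.exists_mem_inertia_smul_geomTorsion_ne_of_hasAdditiveReductionAt
    (hasAdditiveReductionAt_of_sq_dvd_conductorNorm V hq hv hsq) le_rfl h3v

/-- Unramified form, negated: it is NOT the case that the inertia group at `v ∋ q` fixes `V[3](ℚ̄)` pointwise.
[cite: SilvermanAEC2009, Thm. VII.6.1 and proof of Thm. VII.7.1] -/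
theorem not_inertia_trivial_on_threeTorsion_of_sq_dvd_conductorNorm (V : WeierstrassCurve ℚ) [V.IsElliptic]
    {q : ℕ} (hq : q.Prime) (hq3 : q ≠ 3) (hsq : q ^ 2 ∣ V.conductorNorm ℤ)
    (v : HeightOneSpectrum (𝓞 ℚ)) (hv : (q : 𝓞 ℚ) ∈ v.asIdeal) :
    ¬ ∀ σ ∈ GreenbergSelmer.inertia v, ∀ P : geomTorsion V (3 : ℤ), σ • P = P := by
  obtain ⟨σ, hσ, P, hP⟩ := exists_mem_inertia_smul_threeTorsion_ne_of_sq_dvd_conductorNorm V hq hq3 hsq v hv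
  exact fun h ↦ hP (h σ hσ P)

/-! ## §4 The Cartan-cover specialisation: binders of D4 ∕ OBS -/

/-- `q ∈ C` and `D · M · ∏_{p ∈ C} p² = N = N(V)` give `q² ∣ N(V)`. [folklore] -/
theorem sq_dvd_conductorNorm_of_mem_cartanPlaces (V : WeierstrassCurve ℚ) {N D M : ℕ} {C : Finset ℕ} {q : ℕ}
    (hq : q ∈ C) (hN : V.conductorNorm ℤ = N) (hDMC : D * M * ∏ p ∈ C, p ^ 2 = N) : q ^ 2 ∣ V.conductorNorm ℤ := by
  rw [hN, ← hDMC]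
  exact (Finset.dvd_prod_of_mem (fun p ↦ p ^ 2) hq).mul_left _

/-- In the setting of D4 ∕ OBS the place over `q ∈ C` is ADDITIVE for `V` (so `q` is a genuine Cartan place of `V`).
[cite: Silverman1994, IV.10.2(c)] -/
theorem hasAdditiveReductionAt_of_mem_cartanPlaces (V : WeierstrassCurve ℚ) [V.IsElliptic]
    {N D M : ℕ} {C : Finset ℕ} {q : ℕ} [Fact q.Prime] (hq : q ∈ C) (hN : V.conductorNorm ℤ = N)
    (hDMC : D * M * ∏ p ∈ C, p ^ 2 = N) (v : HeightOneSpectrum (𝓞 ℚ)) (hv : (q : 𝓞 ℚ) ∈ v.asIdeal) :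
    V.HasAdditiveReductionAt v :=
  hasAdditiveReductionAt_of_sq_dvd_conductorNorm V Fact.out hv (sq_dvd_conductorNorm_of_mem_cartanPlaces V hq hN hDMC)

/-- **RAM at a Cartan place.** In the setting of D4 ∕ OBS (`q ∈ C`, `q ≠ 3`, `N(V) = D · M · ∏_{p ∈ C} p²`): at every place
`v ∋ q` of `𝓞 ℚ` some `σ ∈ I_v` moves some `P ∈ V[3](ℚ̄)` — `ρ̄_{V,3}` is ramified at `q`.
[cite: SilvermanAEC2009, Thm. VII.6.1 and proof of Thm. VII.7.1] [cite: Silverman1994, IV.10.2(c)] -/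
theorem exists_mem_inertia_smul_threeTorsion_ne_of_mem_cartanPlaces (V : WeierstrassCurve ℚ) [V.IsElliptic]
    {N D M : ℕ} {C : Finset ℕ} {q : ℕ} [Fact q.Prime] (hq : q ∈ C) (hN : V.conductorNorm ℤ = N)
    (hDMC : D * M * ∏ p ∈ C, p ^ 2 = N) (hq3 : q ≠ 3) (v : HeightOneSpectrum (𝓞 ℚ)) (hv : (q : 𝓞 ℚ) ∈ v.asIdeal) :
    ∃ σ ∈ GreenbergSelmer.inertia v, ∃ P : geomTorsion V (3 : ℤ), σ • P ≠ P :=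
  exists_mem_inertia_smul_threeTorsion_ne_of_sq_dvd_conductorNorm V Fact.out hq3
    (sq_dvd_conductorNorm_of_mem_cartanPlaces V hq hN hDMC) v hv

/-- **The conclusion CAR must reach is FALSE for `V`** (so OBS ⟸ CAR by contradiction): in the setting of D4 ∕ OBS it is NOT
the case that `V[3](ℚ̄)` is fixed pointwise by the inertia group of every place over `q`.
[cite: SilvermanAEC2009, Thm. VII.6.1 and proof of Thm. VII.7.1] [cite: Silverman1994, IV.10.2(c)] -/
theorem not_threeTorsion_unramified_of_mem_cartanPlaces (V : WeierstrassCurve ℚ) [V.IsElliptic]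
    {N D M : ℕ} {C : Finset ℕ} {q : ℕ} [Fact q.Prime] (hq : q ∈ C) (hN : V.conductorNorm ℤ = N)
    (hDMC : D * M * ∏ p ∈ C, p ^ 2 = N) (hq3 : q ≠ 3) :
    ¬ ∀ v : HeightOneSpectrum (𝓞 ℚ), (q : 𝓞 ℚ) ∈ v.asIdeal →
        ∀ σ ∈ GreenbergSelmer.inertia v, ∀ P : geomTorsion V (3 : ℤ), σ • P = P := by
  intro h
  -- the place of `𝓞 ℚ` over `q` (`Rat.HeightOneSpectrum.primesEquiv`; cf. tree `Literature.NumberTheory.EllipticCurves.exists_natCast_mem_asIdeal`)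
  have hv := natCast_mem_asIdeal_primesEquiv_symm (Fact.out : q.Prime)
  obtain ⟨σ, hσ, P, hP⟩ := exists_mem_inertia_smul_threeTorsion_ne_of_mem_cartanPlaces V hq hN hDMC hq3 _ hv
  exact hP (h _ hv σ hσ P)

end Summit.BirchSwinnertonDyer.BirchSwinnertonDyer.Theorems.CartanCarayol
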